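import Summits.HubbardSuperconductivity.HubbardSuperconductivity.Theorems.AnisotropyChordTransferSectorZeroGround

/-!
# Route `AnisotropyChord` / H0 rotor rung, route (1): THEOREM L1 (level-one ordering) and the strict / unique form of THEOREM Z⁺ —
# INFRASTRUCTURE (block minima, block Perron–Frobenius with a block-local bound, transport of product operators, the parity operator)

Theory seat `hubbard-h0-rotor-theory-1` g12, THEOREM-L1.md / PartF.lean / memo ROTOR-THEORY-12 §178, §181 (THEOREM L1: `E(±1) < E(M)` for
`|M| ≥ 2`; Z⁺ with uniqueness: `E(0) < E(M)` for `M ≠ 0` and the ground state is unique).  This file supplies the extra linear algebra on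
top of `…TransferParityFlips/FlipEntries/FlipPinning/SectorZeroGround`:

* `parityBlock_perronFrobenius_local` — Perron–Frobenius on a parity block when the energy bounds the quadratic form only ON THE BLOCK
  (needed for the odd block, whose minimum `E_o` lies above the ground energy);
* `paritySubmodule r` = the coordinate subspace of the parity class `r` as the kernel of a diagonal indicator, `mem_paritySubmodule_iff`,
  and the block minimum via the tree's `sector_groundState` (`exists_blockGround`);
* `conj_productOp_const` — a unitary that conjugates `onSite x a` to `onSite x b` at every site conjugates `⨂a` to `⨂b`;
* the flip operator `⨂σˣ` (`flipXOp_mulVec`: `v ↦ v ∘ σ̄`) and the parity operator `⨂(−σᶻ)` (`parityOp_mulVec`: `v(σ) ↦ (−1)^{Σσ} v(σ)` on an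
  even number of sites); under the tree's frame change (`Sˣ ↦ −Sᶻ`) the former is carried to the latter (`frame_conj_flipXOp`).

All folklore.  Prover seat `hubbard-h0-rotor-p1` g14.
-/

set_option linter.dupNamespace false
set_option autoImplicit false

noncomputable section

open Finset Matrix
open scoped ComplexOrder
open Literature.MathematicalPhysics.QuantumLattice

namespace Summit.HubbardSuperconductivity.HubbardSuperconductivity.Theorems.AnisotropyChord.Transfer

/-! ## Perron–Frobenius on a parity block with a block-local energy bound -/

section BlockLocal

variable {Λ : Type*} [Fintype Λ] [DecidableEq Λ] (G : SimpleGraph Λ)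

/-- **Perron–Frobenius on a parity block, block-local bound.**  As `parityBlock_perronFrobenius`, but the energy `E` is only assumed to
bound the quadratic form of `H` on vectors SUPPORTED IN THE CLASS `r` (so `E` may be the block minimum rather than the ground energy).
[folklore] -/
theorem parityBlock_perronFrobenius_local (hG : G.Connected) (H : Op Λ 2)
    (hreal : ∀ σ τ : TensorIndex Λ 2, star (H σ τ) = H σ τ)
    (hsymm : ∀ σ τ : TensorIndex Λ 2, H σ τ = H τ σ)
    (hoff : ∀ σ τ : TensorIndex Λ 2, σ ≠ τ → (H σ τ).re ≤ 0)
    (hflip : ∀ (x y : Λ) (σ : TensorIndex Λ 2), G.Adj x y → H σ (flipAt x (flipAt y σ)) ≠ 0) (r : ℕ)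
    {E : ℝ} (hE : ∀ v : TensorIndex Λ 2 → ℂ, (∀ σ, (∑ z, (σ z : ℕ)) % 2 ≠ r → v σ = 0) →
      E * (star v ⬝ᵥ v).re ≤ (star v ⬝ᵥ H *ᵥ v).re) :
    (∀ w : TensorIndex Λ 2 → ℂ, w ≠ 0 → (∀ σ, (∑ z, (σ z : ℕ)) % 2 ≠ r → w σ = 0) →
      H *ᵥ w = (E : ℂ) • w →
        ∃ c : ℂ, c ≠ 0 ∧ ∀ σ, (∑ z, (σ z : ℕ)) % 2 = r → 0 < (c * w σ).re ∧ (c * w σ).im = 0) ∧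
    (∀ w w' : TensorIndex Λ 2 → ℂ, (∀ σ, (∑ z, (σ z : ℕ)) % 2 ≠ r → w σ = 0) →
      (∀ σ, (∑ z, (σ z : ℕ)) % 2 ≠ r → w' σ = 0) →
      H *ᵥ w = (E : ℂ) • w → H *ᵥ w' = (E : ℂ) • w' → w ≠ 0 → ∃ c : ℂ, w' = c • w) := by
  -- the compression of `H` to the class
  set ι := {σ : TensorIndex Λ 2 // (∑ z, (σ z : ℕ)) % 2 = r}
  set B : Matrix ι ι ℂ := Matrix.of fun s t => H s.1 t.1 with hBdef
  have hBapply : ∀ s t : ι, B s t = H s.1 t.1 := fun s t => rfl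
  have hBreal : ∀ s t : ι, star (B s t) = B s t := fun s t => hreal _ _
  have hBsymm : ∀ s t : ι, B s t = B t s := fun s t => hsymm _ _
  have hBoff : ∀ s t : ι, s ≠ t → (B s t).re ≤ 0 := fun s t hst =>
    hoff _ _ (fun h => hst (Subtype.ext h))
  have hconn : ∀ s t : ι, Relation.ReflTransGen (fun a b => B a b ≠ 0) s t := by
    have key : ∀ σ τ : TensorIndex Λ 2, Relation.ReflTransGen (DoubleFlipRel G) σ τ →
        ∀ hσ : (∑ z, (σ z : ℕ)) % 2 = r, ∃ hτ : (∑ z, (τ z : ℕ)) % 2 = r,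
          Relation.ReflTransGen (fun a b : ι => B a b ≠ 0) ⟨σ, hσ⟩ ⟨τ, hτ⟩ := by
      intro σ τ h
      induction h with
      | refl => exact fun hσ => ⟨hσ, Relation.ReflTransGen.refl⟩
      | @tail b c _ hbc ih =>
        intro hσ
        obtain ⟨hb, hpath⟩ := ih hσ
        obtain ⟨x, y, hxy, rfl⟩ := hbc
        have hc : (∑ z, (flipAt x (flipAt y b) z : ℕ)) % 2 = r := by rw [weight_flipAt_flipAt_mod_two]; exact hb
        exact ⟨hc, hpath.tail (by rw [hBapply]; exact hflip x y b hxy)⟩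
    intro s t
    obtain ⟨_, h⟩ := key s.1 t.1 (reflTransGen_doubleFlip_of_parity G hG s.1 t.1 (by rw [s.2, t.2])) s.2
    exact h
  have hdot : ∀ (v : ι → ℂ) (w : TensorIndex Λ 2 → ℂ),
      star (fun σ => if h : (∑ z, (σ z : ℕ)) % 2 = r then v ⟨σ, h⟩ else 0) ⬝ᵥ w =
        star v ⬝ᵥ fun s => w s.1 := by
    intro v w
    rw [dotProduct, dotProduct, sum_eq_sum_subtype_of_support (fun σ => (∑ z, (σ z : ℕ)) % 2 = r)]
    · refine Finset.sum_congr rfl fun s _ => ?_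
      rw [Pi.star_apply, Pi.star_apply, dif_pos s.2]
    · intro σ hσ
      rw [Pi.star_apply, dif_neg hσ, star_zero, zero_mul]
  have hHext : ∀ (v : ι → ℂ) (s : ι),
      (H *ᵥ fun σ => if h : (∑ z, (σ z : ℕ)) % 2 = r then v ⟨σ, h⟩ else 0) s.1 = (B *ᵥ v) s := by
    intro v s
    rw [mulVec, dotProduct, mulVec, dotProduct,
      sum_eq_sum_subtype_of_support (fun σ => (∑ z, (σ z : ℕ)) % 2 = r)]
    · refine Finset.sum_congr rfl fun t _ => ?_
      rw [dif_pos t.2, hBapply, Subtype.coe_eta]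
    · intro τ hτ
      rw [dif_neg hτ, mul_zero]
  have hEB : ∀ v : ι → ℂ, E * (star v ⬝ᵥ v).re ≤ (star v ⬝ᵥ B *ᵥ v).re := by
    intro v
    set φ : TensorIndex Λ 2 → ℂ := fun σ => if h : (∑ z, (σ z : ℕ)) % 2 = r then v ⟨σ, h⟩ else 0 with hφdef
    have hφsupp : ∀ σ, (∑ z, (σ z : ℕ)) % 2 ≠ r → φ σ = 0 := fun σ hσ => by rw [hφdef]; exact dif_neg hσ
    have hφφ : star φ ⬝ᵥ φ = star v ⬝ᵥ v := by
      rw [hφdef, hdot]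
      congr 1
      funext s
      rw [dif_pos s.2]
    have hφH : star φ ⬝ᵥ H *ᵥ φ = star v ⬝ᵥ B *ᵥ v := by
      rw [hφdef, hdot]
      congr 1
      funext s
      rw [hHext]
    have := hE φ hφsupp
    rw [hφφ, hφH] at this
    exact this
  have hres : ∀ φ : TensorIndex Λ 2 → ℂ, (∀ σ, (∑ z, (σ z : ℕ)) % 2 ≠ r → φ σ = 0) →
      H *ᵥ φ = (E : ℂ) • φ → B *ᵥ (fun s : ι => φ s.1) = (E : ℂ) • fun s : ι => φ s.1 := by
    intro φ hφ hHφ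
    funext s
    rw [Pi.smul_apply, smul_eq_mul, mulVec, dotProduct]
    have h := congrFun hHφ s.1
    rw [Pi.smul_apply, smul_eq_mul, mulVec, dotProduct,
      sum_eq_sum_subtype_of_support (fun σ => (∑ z, (σ z : ℕ)) % 2 = r)] at h
    · exact h
    · intro τ hτ
      rw [hφ τ hτ, mul_zero]
  have hres0 : ∀ φ : TensorIndex Λ 2 → ℂ, (∀ σ, (∑ z, (σ z : ℕ)) % 2 ≠ r → φ σ = 0) → φ ≠ 0 →
      (fun s : ι => φ s.1) ≠ 0 := by
    intro φ hφ hφ0 h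
    apply hφ0
    funext σ
    by_cases hσ : (∑ z, (σ z : ℕ)) % 2 = r
    · exact congrFun h ⟨σ, hσ⟩
    · exact hφ σ hσ
  refine ⟨?_, ?_⟩
  · intro w hw0 hw hHw
    obtain ⟨c, hc0, hcpos⟩ := perronFrobenius_groundState_smul_pos hBsymm hBreal hBoff hconn hEB
      (hres w hw hHw) (hres0 w hw hw0)
    exact ⟨c, hc0, fun σ hσ => hcpos ⟨σ, hσ⟩⟩
  · intro w w' hw hw' hHw hHw' hw0
    obtain ⟨c, hc⟩ := perronFrobenius_groundState_unique hBsymm hBreal hBoff hconn hEB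
      (hres w hw hHw) (hres w' hw' hHw') (hres0 w hw hw0)
    refine ⟨c, funext fun σ => ?_⟩
    by_cases hσ : (∑ z, (σ z : ℕ)) % 2 = r
    · have h := congrFun hc ⟨σ, hσ⟩
      simpa only [Pi.smul_apply, smul_eq_mul] using h
    · rw [Pi.smul_apply, smul_eq_mul, hw σ hσ, hw' σ hσ, mul_zero]

/-! ## The parity classes as coordinate submodules; block minima -/

/-- the coordinate subspace of the parity class `r`, as the kernel of the diagonal indicator of its complement. [folklore] -/
def paritySubmodule (r : ℕ) : Submodule ℂ (TensorIndex Λ 2 → ℂ) :=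
  LinearMap.ker (Matrix.toLin' (Matrix.diagonal fun σ : TensorIndex Λ 2 =>
    if (∑ z, (σ z : ℕ)) % 2 = r then (0 : ℂ) else 1))

/-- membership in the parity subspace = vanishing off the class. [folklore] -/
theorem mem_paritySubmodule_iff (r : ℕ) (v : TensorIndex Λ 2 → ℂ) :
    v ∈ paritySubmodule (Λ := Λ) r ↔ ∀ σ, (∑ z, (σ z : ℕ)) % 2 ≠ r → v σ = 0 := by
  rw [paritySubmodule, LinearMap.mem_ker, Matrix.toLin'_apply]
  constructor
  · intro h σ hσ
    have := congrFun h σ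
    rw [Matrix.mulVec_diagonal, if_neg hσ, one_mul] at this
    exact this
  · intro h
    funext σ
    rw [Matrix.mulVec_diagonal, Pi.zero_apply]
    by_cases hσ : (∑ z, (σ z : ℕ)) % 2 = r
    · rw [if_pos hσ, zero_mul]
    · rw [if_neg hσ, h σ hσ, mul_zero]

/-- **the block minimum is attained**: for a Hermitian parity-preserving `H` and a non-empty parity class `r`, the minimum `E_r` of
the Rayleigh quotient over the class is attained by an eigenvector supported in the class, and bounds the quadratic form on the class
(tree `sector_groundState`). [folklore] -/
theorem exists_blockGround (H : Op Λ 2) (hH : H.IsHermitian)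
    (hpar : ∀ σ τ : TensorIndex Λ 2, (∑ z, (σ z : ℕ)) % 2 ≠ (∑ z, (τ z : ℕ)) % 2 → H σ τ = 0) (r : ℕ)
    (hr : ∃ σ : TensorIndex Λ 2, (∑ z, (σ z : ℕ)) % 2 = r) :
    (∃ v : TensorIndex Λ 2 → ℂ, (∀ σ, (∑ z, (σ z : ℕ)) % 2 ≠ r → v σ = 0) ∧ v ≠ 0 ∧
        H *ᵥ v = ((H.minEnergyOn (paritySubmodule (Λ := Λ) r) : ℝ) : ℂ) • v) ∧
      ∀ v : TensorIndex Λ 2 → ℂ, (∀ σ, (∑ z, (σ z : ℕ)) % 2 ≠ r → v σ = 0) →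
        H.minEnergyOn (paritySubmodule (Λ := Λ) r) * (star v ⬝ᵥ v).re ≤ (star v ⬝ᵥ H *ᵥ v).re := by
  have hK : ∀ v, v ∈ paritySubmodule (Λ := Λ) r ↔ ∀ σ, ¬((∑ z, (σ z : ℕ)) % 2 = r) → v σ = 0 :=
    mem_paritySubmodule_iff r
  obtain ⟨h1, h2⟩ := sector_groundState H hH (fun σ : TensorIndex Λ 2 => (∑ z, (σ z : ℕ)) % 2 = r) hr
    (fun σ τ hσ hτ => hpar σ τ (by rw [hτ]; exact hσ)) (paritySubmodule (Λ := Λ) r) hK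
  refine ⟨?_, ?_⟩
  · obtain ⟨v, hvK, hv0, hHv⟩ := h1
    exact ⟨v, (hK v).1 hvK, hv0, hHv⟩
  · intro v hv
    exact LiebMattis.mul_norm_le_of_unit_bound 1 H (paritySubmodule (Λ := Λ) r) h2 ((hK v).2 hv)

end BlockLocal

/-! ## Transport of product operators; the flip and parity operators -/

section ProductTransport

open Complex Literature.MathematicalPhysics.QuantumLattice.SpinOperators

variable {Λ : Type*} [Fintype Λ] [DecidableEq Λ] {q : ℕ}

/-- **conjugating a product operator site by site**: if `UᴴU = UUᴴ = 1` and `U (𝟙⊗a⊗𝟙)_x Uᴴ = (𝟙⊗b⊗𝟙)_x` at every site, then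
`U (⨂_x a) Uᴴ = ⨂_x b`. [folklore] -/
theorem conj_productOp_const {U : Op Λ q} (hU : U * Uᴴ = 1) (hU' : Uᴴ * U = 1) {a b : Matrix (Fin q) (Fin q) ℂ}
    (h : ∀ x : Λ, U * onSite x a * Uᴴ = onSite x b) :
    U * productOp (fun _ : Λ => a) * Uᴴ = productOp (fun _ : Λ => b) := by
  classical
  -- induction on the set of sites carrying the non-trivial factor
  suffices key : ∀ s : Finset Λ,
      U * productOp (fun x : Λ => if x ∈ s then a else 1) * Uᴴ = productOp (fun x : Λ => if x ∈ s then b else 1) by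
    have ha : (fun _ : Λ => a) = fun x : Λ => if x ∈ (Finset.univ : Finset Λ) then a else 1 := by
      funext x; rw [if_pos (Finset.mem_univ x)]
    have hb : (fun _ : Λ => b) = fun x : Λ => if x ∈ (Finset.univ : Finset Λ) then b else 1 := by
      funext x; rw [if_pos (Finset.mem_univ x)]
    rw [ha, hb]; exact key _
  intro s
  induction s using Finset.induction_on with
  | empty =>
    have h0 : (fun x : Λ => if x ∈ (∅ : Finset Λ) then a else 1) = fun _ => (1 : Matrix (Fin q) (Fin q) ℂ) := by
      funext x; simp
    have h0' : (fun x : Λ => if x ∈ (∅ : Finset Λ) then b else 1) = fun _ => (1 : Matrix (Fin q) (Fin q) ℂ) := by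
      funext x; simp
    rw [h0, h0', productOp_one, Matrix.mul_one, hU]
  | @insert x s hxs ih =>
    have split : ∀ c : Matrix (Fin q) (Fin q) ℂ,
        productOp (fun y : Λ => if y ∈ insert x s then c else 1) =
          onSite x c * productOp (fun y : Λ => if y ∈ s then c else 1) := by
      intro c
      rw [onSite_eq_productOp, productOp_mul]
      congr 1
      funext y
      by_cases hy : y = x
      · subst hy
        rw [Function.update_self, if_pos (Finset.mem_insert_self y s), if_neg hxs, Matrix.mul_one]
      · rw [Function.update_of_ne hy, Matrix.one_mul]
        by_cases hys : y ∈ s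
        · rw [if_pos hys, if_pos (Finset.mem_insert_of_mem hys)]
        · rw [if_neg hys, if_neg (by rw [Finset.mem_insert]; push Not; exact ⟨hy, hys⟩)]
    rw [split a, split b]
    calc U * (onSite x a * productOp fun y => if y ∈ s then a else 1) * Uᴴ
        = (U * onSite x a * Uᴴ) * (U * productOp (fun y => if y ∈ s then a else 1) * Uᴴ) := by
          simp only [Matrix.mul_assoc]
          rw [← Matrix.mul_assoc Uᴴ U, hU', Matrix.one_mul]
      _ = onSite x b * productOp (fun y => if y ∈ s then b else 1) := by rw [h x, ih]

/-- entries of `σˣ`. [folklore] -/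
theorem pauliX_apply (k l : Fin 2) : spinHalfPauli 0 k l = if l = 1 - k then (1 : ℂ) else 0 := by
  fin_cases k <;> fin_cases l <;> simp [spinHalfPauli]

/-- entries of `−σᶻ`. [folklore] -/
theorem neg_pauliZ_apply (k l : Fin 2) : (-spinHalfPauli 2) k l = if l = k then -((-1 : ℂ) ^ (k : ℕ)) else 0 := by
  fin_cases k <;> fin_cases l <;> simp [spinHalfPauli]

/-- **the flip operator `⨂σˣ` acts by the global flip**: `(⨂σˣ v)(σ) = v(σ̄)`. [folklore] -/
theorem flipXOp_mulVec (v : (Λ → Fin 2) → ℂ) (σ : Λ → Fin 2) :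
    (productOp (fun _ : Λ => spinHalfPauli 0) *ᵥ v) σ = v (fun z => 1 - σ z) := by
  rw [Matrix.mulVec, dotProduct, Finset.sum_eq_single (fun z => 1 - σ z)]
  · rw [productOp_apply]
    have : (∏ x, spinHalfPauli 0 (σ x) ((fun z => 1 - σ z) x)) = 1 :=
      Finset.prod_eq_one fun x _ => by rw [pauliX_apply, if_pos rfl]
    rw [this, one_mul]
  · intro τ _ hτ
    obtain ⟨z, hz⟩ : ∃ z, τ z ≠ 1 - σ z := by
      by_contra hcon; push Not at hcon; exact hτ (funext hcon)
    rw [productOp_apply, Finset.prod_eq_zero (Finset.mem_univ z) (by rw [pauliX_apply, if_neg hz]), zero_mul]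
  · intro h; exact absurd (Finset.mem_univ _) h

/-- **the parity operator `⨂(−σᶻ)` on an even number of sites acts by the weight sign**: `(⨂(−σᶻ) v)(σ) = (−1)^{Σσ} v(σ)`. [folklore] -/
theorem parityOp_mulVec {m : ℕ} (hm : Fintype.card Λ = 2 * m) (v : (Λ → Fin 2) → ℂ) (σ : Λ → Fin 2) :
    (productOp (fun _ : Λ => -spinHalfPauli 2) *ᵥ v) σ = (-1) ^ (∑ z, (σ z : ℕ)) * v σ := by
  rw [Matrix.mulVec, dotProduct, Finset.sum_eq_single σ]
  · rw [productOp_apply]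
    have : (∏ x, (-spinHalfPauli 2) (σ x) (σ x)) = (-1) ^ (∑ z, (σ z : ℕ)) := by
      rw [Finset.prod_congr rfl fun x _ => by rw [neg_pauliZ_apply, if_pos rfl], Finset.prod_neg, Finset.card_univ, hm,
        pow_mul, neg_one_sq, one_pow, one_mul, Finset.prod_pow_eq_pow_sum]
    rw [this]
  · intro τ _ hτ
    obtain ⟨z, hz⟩ : ∃ z, τ z ≠ σ z := by
      by_contra hcon; push Not at hcon; exact hτ (funext hcon)
    rw [productOp_apply, Finset.prod_eq_zero (Finset.mem_univ z) (by rw [neg_pauliZ_apply, if_neg hz]), zero_mul]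
  · intro h; exact absurd (Finset.mem_univ _) h

/-- **the frame change carries the flip to the parity operator**: a unitary with `U Sˣ_x Uᴴ = −Sᶻ_x` at every site satisfies
`U (⨂σˣ) Uᴴ = ⨂(−σᶻ)`. [folklore] -/
theorem frame_conj_flipXOp {U : Op Λ 2} (hU : U * Uᴴ = 1) (hU' : Uᴴ * U = 1)
    (hUx : ∀ x : Λ, U * siteSpin 1 x 0 * Uᴴ = -siteSpin 1 x 2) :
    U * productOp (fun _ : Λ => spinHalfPauli 0) * Uᴴ = productOp (fun _ : Λ => -spinHalfPauli 2) := by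
  refine conj_productOp_const hU hU' fun x => ?_
  have h2 : spinHalfPauli 0 = (2 : ℂ) • spinX 1 := by
    have := spinVec_one_eq_half_spinHalfPauli 0
    rw [spinVec_zero] at this
    rw [this, smul_smul]; norm_num
  have h2' : -spinHalfPauli 2 = (2 : ℂ) • (-SpinOperators.spinZ 1) := by
    have := spinVec_one_eq_half_spinHalfPauli 2
    rw [spinVec_two] at this
    rw [this, smul_neg, smul_smul]; norm_num
  rw [h2, h2', onSite_smul', onSite_smul', Matrix.mul_smul, Matrix.smul_mul, onSite_neg']
  have hx := hUx x
  rw [siteSpin, siteSpin, spinVec_zero, spinVec_two] at hx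
  rw [hx]

end ProductTransport

end Summit.HubbardSuperconductivity.HubbardSuperconductivity.Theorems.AnisotropyChord.Transfer
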